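import Summits.CriticalPhenomena.PercolationContinuityZ3.Theorems.PercNearOneGluingNoHeavyLowerTailOneCutCertSound
import Summits.CriticalPhenomena.PercolationContinuityZ3.Theorems.PercNearOneGluingNoHeavyLowerTailOneCutCertExpand
import HarnessLib

/-!
# FAR (`Quant.FarRelayRow`) instances by KRONECKER-checked box certificates: the checker `farCheck` and its soundness

builds on p205010 (kernel theorem, internal audit signed; external expert review pending)

Support file (`--supports stmt-CriticalPhenomena-4575`), seat `prim-cert-1` (gen 9).  This is the FAR-family twin of prim-cert-2's
box-certificate checker `OneCutCert.boxCheck` / `boxCheck_sound` (…OneCutCertCheck / …OneCutCertSound, one-cut targets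
`1[a ↮ a'] − 1[1 ≤ N ≤ 2]`, hypothesis `N − 4`): here the TARGETS are indexed by the relay list itself, `T_v = 1[o ↮ v] − 1[N ≤ j]`
(`rawFar`), and the HYPOTHESIS is `H = N − 2j` (`rawHF`), for an arbitrary layer `j`.  Everything else — boxes `φ : Fin m → Fin 3`
(`F = [0,1]`, `L = [0,½]`, `H = [½,1]` per coordinate), the de Casteljau transform `boxTr`, the base-`2^s` Kronecker numbers `krN`/`krZ`
and the AND-mask digit test — is prim-cert-2's machinery, reused verbatim; the soundness proof is `boxCheck_sound` transcribed.

* `farCheck n o rel j φ s lam cc` — the check (COMPUTATIONAL when evaluated; meant for `native_decide` in instance files);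
* `farCheck_sound` — if it passes then at every weight vector strictly inside the box with `2j < Σ_{v∈rel} P(o ↔ v)` and all cuts
  `P(o ↮ v) ≤ t` (`v ∈ rel`): `P(#{v ∈ rel : o ↔ v} ≤ j) ≤ t` — i.e. the FAR instance `TwoCopy.FARp` on the open box.

Purpose: two-copy certificates on `m = 15` coordinates (six vertices), where the fibre-enumerating checker `TwoCopy.twoCopyCheck` is
too slow (`O(6^m)`), and BOXED certificates where plain bidegree-2 certificates do not exist (kit j099101/j099102: none for `Z(3,2)` with
two Steiner vertices nor for `|A| = 5`, `j = 2` on six vertices; j099099: one exists for `|A| = 4`, `j = 1`).  No sorries; standard axioms;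
nothing here asserts anything about FAR itself.
-/

namespace Summit.CriticalPhenomena.PercolationContinuityZ3.Theorems.FarKron

open Finset MeasureTheory
open scoped BigOperators
open Literature.Probability.Percolation Literature.Probability.LatticeModels
open Summit.CriticalPhenomena.PercolationContinuityZ3.Theorems.AdditiveGluing.Negative.Cert
open Summit.CriticalPhenomena.PercolationContinuityZ3.Theorems.OneCutCert
open scoped Classical

variable {n : ℕ}

/-! ## The raw tables of a FAR instance -/

/-- Entry of the target table `1[o ↮ v] − 1[N ≤ j]` from a reach table. [this work] -/
def farOfRT {n : ℕ} (o : Fin n) (rel : List (Fin n)) (j : ℕ) (v : Fin n) (rt : List ℕ) : ℤ :=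
  let N := NofRT rt o rel
  (if (rt.getD o 0).testBit v then 0 else 1) - (if N ≤ j then 1 else 0)

/-- Entry of the hypothesis table `N − 2j` from a reach table. [this work] -/
def hfOfRT {n : ℕ} (o : Fin n) (rel : List (Fin n)) (j : ℕ) (rt : List ℕ) : ℤ :=
  (NofRT rt o rel : ℤ) - 2 * j

/-- Raw integer table of `1[o ↮ v] − 1[N ≤ j]`, indexed by bitmask. [this work] -/
def rawFar (n : ℕ) (o : Fin n) (rel : List (Fin n)) (j : ℕ) (v : Fin n) : List ℤ :=
  (List.range (2 ^ mE n)).map fun m => farOfRT o rel j v (reachTable n (cfgM n m))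

/-- Raw integer table of `N − 2j`, indexed by bitmask. [this work] -/
def rawHF (n : ℕ) (o : Fin n) (rel : List (Fin n)) (j : ℕ) : List ℤ :=
  (List.range (2 ^ mE n)).map fun m => hfOfRT o rel j (reachTable n (cfgM n m))

/-- `rawFar` from the shared reach tables. [this work] -/
theorem rawFar_eq_map (n : ℕ) (o : Fin n) (rel : List (Fin n)) (j : ℕ) (v : Fin n) :
    (baseRT n).map (farOfRT o rel j v) = rawFar n o rel j v := by
  unfold baseRT rawFar; rw [List.map_map]; rfl

/-- `rawHF` from the shared reach tables. [this work] -/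
theorem rawHF_eq_map (n : ℕ) (o : Fin n) (rel : List (Fin n)) (j : ℕ) :
    (baseRT n).map (hfOfRT o rel j) = rawHF n o rel j := by
  unfold baseRT rawHF; rw [List.map_map]; rfl

/-- Length of `rawFar`. [this work] -/
theorem length_rawFar (o : Fin n) (rel : List (Fin n)) (j : ℕ) (v : Fin n) :
    (rawFar n o rel j v).length = 2 ^ mE n := by simp [rawFar]

/-- Length of `rawHF`. [this work] -/
theorem length_rawHF (o : Fin n) (rel : List (Fin n)) (j : ℕ) : (rawHF n o rel j).length = 2 ^ mE n := by
  simp [rawHF]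

/-- Entries of `rawFar`. [this work] -/
theorem tabOf_rawFar (o : Fin n) (rel : List (Fin n)) (hrel : rel.Nodup) (j : ℕ) (v : Fin n)
    (g : Fin (mE n) → Bool) :
    tabOf (rawFar n o rel j v) g =
      (if connB g o v then 0 else 1) - (if Ncount g o rel.toFinset ≤ j then 1 else 0) := by
  unfold tabOf rawFar farOfRT
  rw [List.getD_eq_getElem?_getD, List.getElem?_map, List.getElem?_range (enc2_lt g)]
  simp only [Option.map_some, Option.getD_some, cfgM_enc2, ← NofCfg_eq, NofCfg_cfg g o rel hrel]
  rfl

/-- Entries of `rawHF`. [this work] -/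
theorem tabOf_rawHF (o : Fin n) (rel : List (Fin n)) (hrel : rel.Nodup) (j : ℕ) (g : Fin (mE n) → Bool) :
    tabOf (rawHF n o rel j) g = (Ncount g o rel.toFinset : ℤ) - 2 * j := by
  unfold tabOf rawHF hfOfRT
  rw [List.getD_eq_getElem?_getD, List.getElem?_map, List.getElem?_range (enc2_lt g)]
  simp only [Option.map_some, Option.getD_some, cfgM_enc2, ← NofCfg_eq, NofCfg_cfg g o rel hrel]

/-- **Table of the layer event**: `P_w(N ≤ j) = ML 1[Ncount ≤ j] (xOf w)`. [this work] -/
theorem real_leLayer_eq_ML (w : Sym2 (Fin n) → unitInterval) (o : Fin n) (A : Finset (Fin n)) (j : ℕ) :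
    (prodBernoulli w).real {ω : BondConfig (Fin n) | (A.filter fun a => ω ∈ openConn o a).card ≤ j}
      = ML (fun g => if Ncount g o A ≤ j then 1 else 0) (xOf w) := by
  classical
  have hB : ∀ ω ω' : Set (Sym2 (Fin n)), openGraph ω = openGraph ω' →
      (ω ∈ {ω : BondConfig (Fin n) | (A.filter fun a => ω ∈ openConn o a).card ≤ j} ↔
       ω' ∈ {ω : BondConfig (Fin n) | (A.filter fun a => ω ∈ openConn o a).card ≤ j}) := by
    intro ω ω' h
    have : (A.filter fun a => ω ∈ openConn o a) = A.filter fun a => ω' ∈ openConn o a :=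
      Finset.filter_congr fun a _ => openConn_of_openGraph o a ω ω' h
    simp only [Set.mem_setOf_eq, this]
  rw [real_eq_ML w _ hB]
  congr 1
  funext g
  unfold evT
  rw [Set.mem_setOf_eq, ← Ncount_eq]
  split_ifs <;> rfl

/-! ## The checker -/

/-- The FAR box-certificate CHECK for the instance `(n, o, rel, layer j, box φ)` and the certificate `(lam, cc)` (nonnegative
multiplier tables indexed by bitmask, one per relay, box coordinates), base `2^s`.  Same shape as `OneCutCert.boxCheck`. [this work] -/
def farCheck (n : ℕ) (o : Fin n) (rel : List (Fin n)) (j : ℕ)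
    (φ : Fin (mE n) → Fin 3) (s : ℕ) (lam : List (List ℕ)) (cc : List ℕ) : Bool :=
  let m := mE n
  let φZ : Fin m → Bool → Bool → ℤ := fun i => phiZ (φ i)
  let P := rel.length
  let base := baseRT n
  let Tl : Fin P → List ℤ := fun k => boxTr m φZ (base.map (farOfRT o rel j (rel[k])))
  let Hl : List ℤ := boxTr m φZ (base.map (hfOfRT o rel j))
  let Z : ℤ := (List.ofFn fun k : Fin P => (krN s m (lam.getD k []) : ℤ) * krZ s m (Tl k)).sum
    - (krN s m cc : ℤ) * krZ s m Hl
  let off : ℤ := 2 ^ (s - 1) * (((2 : ℤ) ^ (s * 3 ^ m) - 1) / (2 ^ s - 1))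
  let bnd : ℕ := 2 ^ m * ((List.ofFn fun k : Fin P => maxNat (lam.getD k []) * maxAbs (Tl k)).sum
    + maxNat cc * maxAbs Hl)
  decide (0 < s) && decide (lam.length = P) && (lam.all fun l => l.length = 2 ^ m)
    && decide (cc.length = 2 ^ m) && decide (bnd < 2 ^ (s - 1))
    && (lam.any fun l => l.any fun x => 0 < x)
    && decide (0 ≤ Z + off) && decide (((Z + off).toNat &&& off.toNat) = off.toNat)

/-- Expand compact multiplier entries `(relay index, mask, value)` (one per symmetry orbit) under a vertex-permutation group
(permutations as image lists, cf. `OneCutCert.permV` / `permMask`) to full tables, one list of length `2^m` per relay: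
`a_{i'}(π·mask) = value` with `rel[i'] = π(rel[i])`. [this work] -/
def expandFarLam (n : ℕ) (rel : List ℕ) (group : List (List ℕ)) (entries : List (ℕ × ℕ × ℕ)) : List (List ℕ) :=
  let K := 2 ^ mE n
  let init : Array (Array ℕ) := Array.replicate rel.length (Array.replicate K 0)
  let arr := entries.foldl (fun acc e =>
    group.foldl (fun acc π =>
      let i' := rel.idxOf (permV π (rel.getD e.1 0))
      acc.modify i' fun row => row.setIfInBounds (permMask n π e.2.1) e.2.2) acc) init
  arr.toList.map Array.toList

/-! ## Soundness -/

set_option maxHeartbeats 800000 in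
/-- **Soundness of the FAR box-certificate check.**  If `farCheck` accepts, then at every weight vector strictly inside the box with
`2j < Σ_{v∈rel} P(o ↔ v)`, the probability of `{#{v ∈ rel : o ↔ v} ≤ j}` is at most `t` whenever every cut `P(o ↮ v)`, `v ∈ rel`,
is at most `t`.  (Transcription of `OneCutCert.boxCheck_sound`.) [this work] -/
theorem farCheck_sound (o : Fin n) (rel : List (Fin n)) (hrel : rel.Nodup) (j : ℕ)
    (φ : Fin (mE n) → Fin 3) (s : ℕ) (lam : List (List ℕ)) (cc : List ℕ)
    (hc : farCheck n o rel j φ s lam cc = true)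
    (w : Sym2 (Fin n) → unitInterval) (hbox : ∀ i, loOf (φ i) < xOf w i ∧ xOf w i < hiOf (φ i))
    (hEN : (2 * j : ℝ) < ∑ a ∈ rel.toFinset, (prodBernoulli w).real (openConn o a))
    (t : ℝ) (hcut : ∀ v ∈ rel, (prodBernoulli w).real (openConn o v)ᶜ ≤ t) :
    (prodBernoulli w).real {ω : BondConfig (Fin n) | (rel.toFinset.filter fun a => ω ∈ openConn o a).card ≤ j} ≤ t := by
  -- unpack the check
  unfold farCheck at hc
  simp only [rawFar_eq_map, rawHF_eq_map, Bool.and_eq_true, decide_eq_true_eq, List.all_eq_true,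
    List.any_eq_true] at hc
  obtain ⟨⟨⟨⟨⟨⟨⟨hs, hlen⟩, hall⟩, hcc⟩, hbnd⟩, hany⟩, hZoff⟩, hland⟩ := hc
  have hab : ∀ i, loOf (φ i) < hiOf (φ i) := fun i => loOf_lt_hiOf (φ i)
  -- box coordinates
  set u : Fin (mE n) → ℝ := fun i => (xOf w i - loOf (φ i)) / (hiOf (φ i) - loOf (φ i)) with hu
  have hu01 : ∀ i, 0 < u i ∧ u i < 1 := fun i =>
    ⟨div_pos (sub_pos.2 (hbox i).1) (sub_pos.2 (hab i)),
      (div_lt_one (sub_pos.2 (hab i))).2 (sub_lt_sub_right (hbox i).2 _)⟩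
  have hucube : InCube u := fun i => ⟨(hu01 i).1.le, (hu01 i).2.le⟩
  have hxu : (fun i => loOf (φ i) + (hiOf (φ i) - loOf (φ i)) * u i) = xOf w := by
    funext i
    simp only [hu]
    field_simp [(sub_pos.2 (hab i)).ne']
    ring
  -- the index type of targets and the tables
  set P := rel.length with hP
  let Tl : Fin P → List ℤ := fun k => boxTr (mE n) (fun i => phiZ (φ i)) (rawFar n o rel j (rel[k]))
  let Hl : List ℤ := boxTr (mE n) (fun i => phiZ (φ i)) (rawHF n o rel j)
  let Λ : Fin P → (Fin (mE n) → Bool) → ℤ := fun k => tabOf ((lam.getD k []).map ((↑) : ℕ → ℤ))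
  let T : Fin P → (Fin (mE n) → Bool) → ℤ := fun k => tabOf (Tl k)
  let C : (Fin (mE n) → Bool) → ℤ := tabOf (cc.map ((↑) : ℕ → ℤ))
  let H : (Fin (mE n) → Bool) → ℤ := tabOf Hl
  have hTlen : ∀ k : Fin P, (Tl k).length = 2 ^ mE n := fun k =>
    length_boxTr (mE n) (fun i => phiZ (φ i)) _ (length_rawFar o rel j _)
  have hHlen : Hl.length = 2 ^ mE n := length_boxTr (mE n) (fun i => phiZ (φ i)) _ (length_rawHF o rel j)
  have hlamlen : ∀ k : Fin P, (lam.getD k []).length = 2 ^ mE n := fun k => by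
    have hk : (k : ℕ) < lam.length := by rw [hlen]; exact k.2
    rw [List.getD_eq_getElem?_getD, List.getElem?_eq_getElem hk, Option.getD_some]
    exact hall _ (List.getElem_mem hk)
  -- Step A: all integer fibre sums are nonnegative
  have hmaxNat : ∀ l : List ℕ, (maxAbs (l.map ((↑) : ℕ → ℤ)) : ℤ) = (maxNat l : ℤ) := fun l => by
    rw [maxAbs_map_natCast]; rfl
  have hA : ∀ k, 0 ≤ certCoefZ Λ T C H k := by
    have hoff : ((2 : ℤ) ^ (s - 1) * ((2 ^ (s * 3 ^ mE n) - 1) / (2 ^ s - 1))) = (maskN s (3 ^ mE n) : ℤ) := by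
      rw [off_eq s _ hs, Finset.mul_sum, maskN_eq_sum s hs]
    rw [hoff, Int.toNat_natCast] at hland
    rw [hoff] at hZoff
    refine certCoefZ_nonneg_of_digit_ge hs ?_ ((_ : ℤ) + _).toNat ?_
      (fun j' hj' => digit_ge_of_land s hs (3 ^ mE n) _ hland j' hj')
    · -- coefficient bound
      intro k
      have h1 : |certCoefZ Λ T C H k| ≤
          ∑ q : Fin P, 2 ^ mE n * ((maxAbs ((lam.getD q []).map ((↑) : ℕ → ℤ)) : ℤ) * maxAbs (Tl q)) +
            2 ^ mE n * ((maxAbs (cc.map ((↑) : ℕ → ℤ)) : ℤ) * maxAbs Hl) := by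
        unfold certCoefZ
        refine (abs_sub _ _).trans (add_le_add ((Finset.abs_sum_le_sum_abs _ _).trans
          (Finset.sum_le_sum fun q _ => abs_pcoef_le _ _ k)) (abs_pcoef_le _ _ k))
      have h2 : (∑ q : Fin P, 2 ^ mE n * ((maxAbs ((lam.getD q []).map ((↑) : ℕ → ℤ)) : ℤ) * maxAbs (Tl q)) +
            2 ^ mE n * ((maxAbs (cc.map ((↑) : ℕ → ℤ)) : ℤ) * maxAbs Hl) : ℤ) =
          ((2 ^ mE n * ((List.ofFn fun k : Fin P => maxNat (lam.getD k []) * maxAbs (Tl k)).sum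
            + maxNat cc * maxAbs Hl) : ℕ) : ℤ) := by
        rw [List.sum_ofFn]
        push_cast
        simp only [hmaxNat, mul_add, Finset.mul_sum]
      rw [h2] at h1
      exact lt_of_le_of_lt h1 (by exact_mod_cast hbnd)
    · -- the number
      rw [Int.toNat_of_nonneg hZoff]
      congr 1
      · unfold certZ
        rw [List.sum_ofFn]
        congr 1
        · refine Finset.sum_congr rfl fun k _ => ?_
          rw [krN_eq s (mE n) _ (hlamlen k), krZ_eq s _ (hTlen k)]
        · rw [krN_eq s (mE n) _ hcc, krZ_eq s _ hHlen]
      · rw [maskN_eq_sum s hs, Finset.sum_range]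
  -- Step B: the certificate form is nonnegative at `u`
  have hF : 0 ≤ certForm (fun k g => (Λ k g : ℝ)) (fun k g => (T k g : ℝ)) (fun g => (C g : ℝ))
      (fun g => (H g : ℝ)) u :=
    certForm_nonneg (fun k => by rw [certCoef_cast]; exact_mod_cast hA k) hucube
  -- Step C: identify the factors
  set μ := prodBernoulli w with hμ
  set A := rel.toFinset with hAset
  set Lo : ℝ := μ.real {ω : BondConfig (Fin n) | (A.filter fun a => ω ∈ openConn o a).card ≤ j} with hLo
  set D : Fin P → ℝ := fun k => μ.real (openConn o (rel[k]))ᶜ with hD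
  set EN : ℝ := ∑ a ∈ A, μ.real (openConn o a) with hENdef
  have hT : ∀ k : Fin P, ML (fun g => (T k g : ℝ)) u = 2 ^ mE n * (D k - Lo) := by
    intro k
    have e1 : (fun g => (T k g : ℝ)) = fun g => 2 ^ mE n * boxT (fun i => loOf (φ i)) (fun i => hiOf (φ i))
        (fun h => (tabOf (rawFar n o rel j (rel[k])) h : ℝ)) g := by
      funext g; exact boxTr_phiZ_eq φ _ (length_rawFar o rel j _) g
    rw [e1, ML_smul, ← ML_box, hxu]
    congr 1
    have e2 : (fun h => (tabOf (rawFar n o rel j (rel[k])) h : ℝ)) =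
        fun h => (if connB h o (rel[k]) then (0 : ℝ) else 1) -
          (if Ncount h o A ≤ j then (1 : ℝ) else 0) := by
      funext h
      rw [tabOf_rawFar o rel hrel j _ h]
      push_cast
      split_ifs <;> simp
    rw [e2, ML_sub, ← real_sep_eq_ML, ← real_leLayer_eq_ML]
  have hH : ML (fun g => (H g : ℝ)) u = 2 ^ mE n * (EN - 2 * j) := by
    have e1 : (fun g => (H g : ℝ)) = fun g => 2 ^ mE n * boxT (fun i => loOf (φ i)) (fun i => hiOf (φ i))
        (fun h => (tabOf (rawHF n o rel j) h : ℝ)) g := by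
      funext g; exact boxTr_phiZ_eq φ _ (length_rawHF o rel j) g
    rw [e1, ML_smul, ← ML_box, hxu]
    congr 1
    have e2 : (fun h => (tabOf (rawHF n o rel j) h : ℝ)) = fun h => (Ncount h o A : ℝ) - 2 * j := by
      funext h; rw [tabOf_rawHF o rel hrel j h]; push_cast; rfl
    rw [e2, ML_sub, ← meanCount_eq_ML, ML_const]
  -- Step D: conclude
  have hlam_nonneg : ∀ k : Fin P, 0 ≤ ML (fun g => (Λ k g : ℝ)) u := fun k =>
    ML_nonneg (fun g => by exact_mod_cast tabOf_natCast_nonneg _ g) hucube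
  have hc_nonneg : 0 ≤ ML (fun g => (C g : ℝ)) u :=
    ML_nonneg (fun g => by exact_mod_cast tabOf_natCast_nonneg _ g) hucube
  have hpos : 0 < ∑ k : Fin P, ML (fun g => (Λ k g : ℝ)) u := by
    obtain ⟨l, hl, x, hx, hxpos⟩ := hany
    obtain ⟨i, hi, rfl⟩ := List.getElem_of_mem hl
    have hiP : i < P := by rw [← hlen]; exact hi
    have hk : 0 < ML (fun g => (Λ ⟨i, hiP⟩ g : ℝ)) u := by
      have : lam.getD i [] = lam[i] := by
        rw [List.getD_eq_getElem?_getD, List.getElem?_eq_getElem hi, Option.getD_some]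
      show 0 < ML (fun g => (tabOf ((lam.getD (⟨i, hiP⟩ : Fin P) []).map ((↑) : ℕ → ℤ)) g : ℝ)) u
      simp only [this]
      exact ML_pos_of_entry _ (this ▸ hlamlen ⟨i, hiP⟩) ⟨x, hx, hxpos⟩ hu01
    exact lt_of_lt_of_le hk (Finset.single_le_sum (fun k _ => hlam_nonneg k) (Finset.mem_univ _))
  have hEpos : 0 ≤ EN - 2 * j := by linarith
  have hbracket : 0 ≤ ∑ k : Fin P, ML (fun g => (Λ k g : ℝ)) u * (D k - Lo) -
      ML (fun g => (C g : ℝ)) u * (EN - 2 * j) := by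
    have : certForm (fun k g => (Λ k g : ℝ)) (fun k g => (T k g : ℝ)) (fun g => (C g : ℝ))
        (fun g => (H g : ℝ)) u = 2 ^ mE n * (∑ k : Fin P, ML (fun g => (Λ k g : ℝ)) u * (D k - Lo) -
          ML (fun g => (C g : ℝ)) u * (EN - 2 * j)) := by
      unfold certForm
      simp_rw [hT, hH]
      have hk : ∀ k : Fin P, ML (fun g => (Λ k g : ℝ)) u * (2 ^ mE n * (D k - Lo)) =
          2 ^ mE n * (ML (fun g => (Λ k g : ℝ)) u * (D k - Lo)) := fun k => by ring
      simp_rw [hk, ← Finset.mul_sum]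
      ring
    rw [this] at hF
    exact (mul_nonneg_iff_of_pos_left (by positivity)).1 hF
  have ht' : ∀ k : Fin P, D k ≤ t := fun k => hcut _ (List.getElem_mem k.2)
  exact le_of_certificate hlam_nonneg hpos hc_nonneg hEpos hbracket ht'

end Summit.CriticalPhenomena.PercolationContinuityZ3.Theorems.FarKron
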